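import Summits.QuantumFields.BalabanUV.T4Continuum.Support.CovariantMeanLatticeDepth
import Literature.Analysis.SpecialFunctions.ExpFDeriv

/-!
# `T4Continuum.CovariantMeanCollarDisc` (cell-tree module `Summits/QuantumFields/BalabanUV/T4Continuum/Support/CovariantMeanCollarDisc.lean`)
# — road P4 of the spine estimate NE1′: THE COLLARED DISC of the IL-dec route (record `t4/b2b-balaban-t4-ne1p-p4/IL-LOC.md` v1.3 §5′)
# — the affine-exponent disc `ζ ↦ (b ↦ exp(B₀_b + ζ·B₁_b))` from the COLLARED base point `exp B₀` (on the road: `B₀ = χ·B`, pure gauge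
# on the inner region, the configuration outside, interpolated in a collar) to the configuration `exp(B₀ + B₁)` (`B₁ = (1−χ)·B`);
# its plaquette variables are bounded to first order by the abelianised sums `‖Σ±(B₀ + ζB₁)‖ ≤ γ₀ + |ζ|γ₁` plus the second-order
# remainder of `T4SegmentCurvature.norm_prod_exp_sub_one_le_first_order` (BY NAME), its potentials by `β₀ + |ζ|β₁`; so it stays
# in every domain CONTAINING the small pure-potential configurations (`ContainsSmall`, p211462), and the OFFSET Schwarz lemma
# (`CovariantMeanLatticeDepth.norm_le_offset_of_disc`, p211631) gives `‖Φ(exp(B₀+B₁))‖ ≤ ‖Φ(exp B₀)‖ + 2N/Λ` — the depth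
# gain for a functional that is only APPROXIMATELY local (the base value is its non-locality tail)
# (cell `pub-balaban`, sub-cell `t4`, ROUND-2 prover seat #4 of BINDER-OWNERS row NE1′, unit `b2b-balaban-t4-ne1p-p4`, generation 3;
# ADDITIVE — imports `Support.CovariantMeanLatticeDepth` and `Literature.Analysis.SpecialFunctions.ExpFDeriv` only; nothing modified)

HONEST FRAMING.  Finite four-torus, rung (B)+1 only.  NOT infinite volume, NOT a mass gap, NOT the Clay problem, NOT summit progress.
HONEST DEPENDENCY: continuum YM on T⁴ ⇐ BetaPertH ∧ nine spine estimates (0/9 proved); BetaPertH ⇐ (D1) ∧ (D4) ∧ CAP+tail; G-an2-4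
gates asym, D1 and NE2/3/4.  Elementary (the exponential in a Banach algebra, one-variable Schwarz); asserts nothing about
T. Bałaban's densities or spaces; `γ₀, γ₁` (the abelianised plaquette sums of the base and of the direction) and `ContainsSmall` are
inputs; every declaration [folklore] and sorry-free.  WHY THIS FILE EXISTS (erratum of the road, journal «ERRATUM … COLLARED»):
the naive base point «pure gauge inside, the configuration outside, glued» has seam plaquettes of the size of the POTENTIALS and lies
outside the birth space at fine birth scales; the collared base point does not, but its disc has a non-zero base potential `B₀`,
which the sibling `CovariantMeanLatticeDisc.disc` (`B₀ = 0`) does not cover.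

CITATION HEADER (lean-in-tree rule).  No page of any source is quoted or attributed here.  Objects re-used BY NAME:
`…T4SegmentCurvature.norm_prod_exp_sub_one_le_first_order` / `exp_sub_one_sub_mono`, `Literature.Analysis.SpecialFunctions.
ExpFDeriv.differentiable_exp`, `CovariantMeanLatticeDisc.ContainsSmall` / `rem` / `rem_mono`, `CovariantMeanLatticeDepth.
norm_le_offset_of_disc`.
-/

noncomputable section

open NormedSpace Set Metric

namespace Summit.QuantumFields.BalabanUV.T4Continuum.CovariantMeanCollarDisc

open Literature.MathematicalPhysics.QuantumFieldTheory.Balaban1983to89.T4SegmentCurvature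
  (norm_prod_exp_sub_one_le_first_order exp_sub_one_sub_mono)
open CovariantMeanLatticeDisc (ContainsSmall rem rem_mono rem_le_sq)

variable {𝔅 : Type*} [Fintype 𝔅] {𝔸 : Type*} [NormedRing 𝔸] [NormedAlgebra ℂ 𝔸] [CompleteSpace 𝔸]
  {F : Type*} [NormedAddCommGroup F] [NormedSpace ℂ F]

/-! ## §1 The collared (affine-exponent) disc -/

/-- THE COLLARED DISC: `cdisc B₀ B₁ ζ = (b ↦ exp(B₀_b + ζ·B₁_b))`; `ζ = 0` is the collared base point `exp B₀`, `ζ = 1` the configuration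
`exp(B₀ + B₁)`. [folklore] -/
def cdisc (B₀ B₁ : 𝔅 → 𝔸) (ζ : ℂ) : 𝔅 → 𝔸 := fun b => exp (B₀ b + ζ • B₁ b)

omit [Fintype 𝔅] [CompleteSpace 𝔸] in
/-- `cdisc B₀ B₁ 0 = exp B₀`. [folklore] -/
@[simp] theorem cdisc_zero (B₀ B₁ : 𝔅 → 𝔸) : cdisc B₀ B₁ 0 = fun b => exp (B₀ b) := by
  funext b; simp [cdisc]

omit [Fintype 𝔅] [CompleteSpace 𝔸] in
/-- `cdisc B₀ B₁ 1 = exp (B₀ + B₁)`. [folklore] -/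
@[simp] theorem cdisc_one (B₀ B₁ : 𝔅 → 𝔸) : cdisc B₀ B₁ 1 = fun b => exp (B₀ b + B₁ b) := by
  funext b; simp [cdisc]

omit [Fintype 𝔅] in
/-- The collared disc is ENTIRE: `exp` is differentiable on the whole Banach algebra (tree `ExpFDeriv.differentiable_exp`) and the
exponent is affine in `ζ`. [folklore] -/
theorem differentiable_cdisc [NormOneClass 𝔸] (B₀ B₁ : 𝔅 → 𝔸) : Differentiable ℂ (cdisc B₀ B₁) := by
  refine differentiable_pi'' fun b => ?_
  have hexp : Differentiable ℂ (exp : 𝔸 → 𝔸) :=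
    Literature.Analysis.SpecialFunctions.ExpFDeriv.differentiable_exp (𝕂 := ℂ)
  have haff : Differentiable ℂ (fun ζ : ℂ => B₀ b + ζ • B₁ b) := by fun_prop
  exact hexp.comp haff

/-! ## §2 Plaquettes and potentials along the collared disc -/

omit [Fintype 𝔅] in
/-- PLAQUETTES: with `‖B₀_b‖ ≤ β₀`, `‖B₁_b‖ ≤ β₁` and the abelianised sums of the plaquette `p` bounded by `γ₀` (base) and `γ₁` (direction),
`‖hol(cdisc ζ)(p) − 1‖ ≤ γ₀ + ‖ζ‖γ₁ + rem(4(β₀ + ‖ζ‖β₁))`. [folklore] -/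
theorem norm_hol_cdisc_sub_one_le (B₀ B₁ : 𝔅 → 𝔸) (p : 𝔅 × 𝔅 × 𝔅 × 𝔅) {β₀ β₁ γ₀ γ₁ : ℝ}
    (hβ₀ : ∀ b, ‖B₀ b‖ ≤ β₀) (hβ₁ : ∀ b, ‖B₁ b‖ ≤ β₁)
    (hγ₀ : ‖B₀ p.1 + B₀ p.2.1 - B₀ p.2.2.1 - B₀ p.2.2.2‖ ≤ γ₀) (hγ₁ : ‖B₁ p.1 + B₁ p.2.1 - B₁ p.2.2.1 - B₁ p.2.2.2‖ ≤ γ₁)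
    (ζ : ℂ) :
    ‖cdisc B₀ B₁ ζ p.1 * cdisc B₀ B₁ ζ p.2.1 * exp (-(B₀ p.2.2.1 + ζ • B₁ p.2.2.1)) * exp (-(B₀ p.2.2.2 + ζ • B₁ p.2.2.2)) - 1‖
      ≤ γ₀ + ‖ζ‖ * γ₁ + rem (4 * (β₀ + ‖ζ‖ * β₁)) := by
  set M : 𝔅 → 𝔸 := fun b => B₀ b + ζ • B₁ b with hM
  have h := norm_prod_exp_sub_one_le_first_order (𝔸 := 𝔸) [M p.1, M p.2.1, -(M p.2.2.1), -(M p.2.2.2)]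
  have hprod : (([M p.1, M p.2.1, -(M p.2.2.1), -(M p.2.2.2)] : List 𝔸).map exp).prod =
      cdisc B₀ B₁ ζ p.1 * cdisc B₀ B₁ ζ p.2.1 * exp (-(B₀ p.2.2.1 + ζ • B₁ p.2.2.1)) * exp (-(B₀ p.2.2.2 + ζ • B₁ p.2.2.2)) := by
    simp [cdisc, hM, mul_assoc]
  have hsum : ([M p.1, M p.2.1, -(M p.2.2.1), -(M p.2.2.2)] : List 𝔸).sum =
      (B₀ p.1 + B₀ p.2.1 - B₀ p.2.2.1 - B₀ p.2.2.2) + ζ • (B₁ p.1 + B₁ p.2.1 - B₁ p.2.2.1 - B₁ p.2.2.2) := by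
    simp only [List.sum_cons, List.sum_nil, add_zero, hM, smul_add, smul_sub]
    abel
  -- the size of each exponent
  have hMb : ∀ b, ‖M b‖ ≤ β₀ + ‖ζ‖ * β₁ := by
    intro b
    calc ‖M b‖ = ‖B₀ b + ζ • B₁ b‖ := rfl
      _ ≤ ‖B₀ b‖ + ‖ζ • B₁ b‖ := norm_add_le _ _
      _ ≤ β₀ + ‖ζ‖ * β₁ := by
          rw [norm_smul]; exact add_le_add (hβ₀ b) (mul_le_mul_of_nonneg_left (hβ₁ b) (norm_nonneg _))
  have hnorms : (([M p.1, M p.2.1, -(M p.2.2.1), -(M p.2.2.2)] : List 𝔸).map (‖·‖)).sum ≤ 4 * (β₀ + ‖ζ‖ * β₁) := by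
    simp only [List.map_cons, List.map_nil, List.sum_cons, List.sum_nil, norm_neg, add_zero]
    have := hMb p.1; have := hMb p.2.1; have := hMb p.2.2.1; have := hMb p.2.2.2
    linarith
  have hS0 : 0 ≤ (([M p.1, M p.2.1, -(M p.2.2.1), -(M p.2.2.2)] : List 𝔸).map (‖·‖)).sum := by
    simp only [List.map_cons, List.map_nil, List.sum_cons, List.sum_nil]; positivity
  have hrem : Real.exp (([M p.1, M p.2.1, -(M p.2.2.1), -(M p.2.2.2)] : List 𝔸).map (‖·‖)).sum - 1 -
      (([M p.1, M p.2.1, -(M p.2.2.1), -(M p.2.2.2)] : List 𝔸).map (‖·‖)).sum ≤ rem (4 * (β₀ + ‖ζ‖ * β₁)) :=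
    exp_sub_one_sub_mono hS0 hnorms
  have hlin : ‖([M p.1, M p.2.1, -(M p.2.2.1), -(M p.2.2.2)] : List 𝔸).sum‖ ≤ γ₀ + ‖ζ‖ * γ₁ := by
    rw [hsum]
    calc ‖(B₀ p.1 + B₀ p.2.1 - B₀ p.2.2.1 - B₀ p.2.2.2) + ζ • (B₁ p.1 + B₁ p.2.1 - B₁ p.2.2.1 - B₁ p.2.2.2)‖
        ≤ ‖B₀ p.1 + B₀ p.2.1 - B₀ p.2.2.1 - B₀ p.2.2.2‖ + ‖ζ • (B₁ p.1 + B₁ p.2.1 - B₁ p.2.2.1 - B₁ p.2.2.2)‖ := norm_add_le _ _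
      _ ≤ γ₀ + ‖ζ‖ * γ₁ := by rw [norm_smul]; exact add_le_add hγ₀ (mul_le_mul_of_nonneg_left hγ₁ (norm_nonneg _))
  rw [hprod] at h
  unfold rem at hrem ⊢
  linarith

omit [Fintype 𝔅] in
/-- QUADRATIC REGIME: for `‖ζ‖ ≤ Λ`, `1 ≤ Λ`, `0 ≤ β₀, β₁, γ₁` and `4Λ(β₀ + β₁) ≤ 1`: the plaquette deviation is
`≤ γ₀ + Λγ₁ + 16Λ²(β₀ + β₁)²`. [folklore] -/
theorem norm_hol_cdisc_sub_one_le_quad (B₀ B₁ : 𝔅 → 𝔸) (p : 𝔅 × 𝔅 × 𝔅 × 𝔅) {β₀ β₁ γ₀ γ₁ Λ : ℝ}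
    (hb0 : 0 ≤ β₀) (hb1 : 0 ≤ β₁) (hg1 : 0 ≤ γ₁) (hβ₀ : ∀ b, ‖B₀ b‖ ≤ β₀) (hβ₁ : ∀ b, ‖B₁ b‖ ≤ β₁)
    (hγ₀ : ‖B₀ p.1 + B₀ p.2.1 - B₀ p.2.2.1 - B₀ p.2.2.2‖ ≤ γ₀) (hγ₁ : ‖B₁ p.1 + B₁ p.2.1 - B₁ p.2.2.1 - B₁ p.2.2.2‖ ≤ γ₁)
    (hΛ : 1 ≤ Λ) (h4 : 4 * Λ * (β₀ + β₁) ≤ 1) {ζ : ℂ} (hζ : ‖ζ‖ ≤ Λ) :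
    ‖cdisc B₀ B₁ ζ p.1 * cdisc B₀ B₁ ζ p.2.1 * exp (-(B₀ p.2.2.1 + ζ • B₁ p.2.2.1)) * exp (-(B₀ p.2.2.2 + ζ • B₁ p.2.2.2)) - 1‖
      ≤ γ₀ + Λ * γ₁ + 16 * Λ ^ 2 * (β₀ + β₁) ^ 2 := by
  have h := norm_hol_cdisc_sub_one_le B₀ B₁ p hβ₀ hβ₁ hγ₀ hγ₁ ζ
  have hζ0 : 0 ≤ ‖ζ‖ := norm_nonneg _
  have hΛ0 : 0 ≤ Λ := zero_le_one.trans hΛ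
  have hmono : 4 * (β₀ + ‖ζ‖ * β₁) ≤ 4 * Λ * (β₀ + β₁) := by nlinarith
  have hr : rem (4 * (β₀ + ‖ζ‖ * β₁)) ≤ 16 * Λ ^ 2 * (β₀ + β₁) ^ 2 := by
    have h1 : rem (4 * (β₀ + ‖ζ‖ * β₁)) ≤ rem (4 * Λ * (β₀ + β₁)) := rem_mono (by positivity) hmono
    have h2 : rem (4 * Λ * (β₀ + β₁)) ≤ (4 * Λ * (β₀ + β₁)) ^ 2 := rem_le_sq (by positivity) h4
    nlinarith
  have hl : ‖ζ‖ * γ₁ ≤ Λ * γ₁ := mul_le_mul_of_nonneg_right hζ hg1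
  linarith

/-! ## §3 Containment and the offset gain along the collared disc -/

omit [Fintype 𝔅] in
/-- THE COLLARED DISC STAYS INSIDE: under `ContainsSmall S plaqs a ρ`, for `‖ζ‖ < Λ` with `4Λ(β₀+β₁) ≤ 1`,
`γ₀ + Λγ₁ + 16Λ²(β₀+β₁)² < a` (all listed plaquettes) and `β₀ + Λβ₁ < ρ`, the point `cdisc B₀ B₁ ζ` lies in `S`. [folklore] -/
theorem mapsTo_cdisc {S : Set (𝔅 → 𝔸)} {plaqs : Set (𝔅 × 𝔅 × 𝔅 × 𝔅)} {a ρ : ℝ} (hS : ContainsSmall S plaqs a ρ)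
    {B₀ B₁ : 𝔅 → 𝔸} {β₀ β₁ γ₀ γ₁ Λ : ℝ} (hb0 : 0 ≤ β₀) (hb1 : 0 ≤ β₁) (hg1 : 0 ≤ γ₁)
    (hβ₀ : ∀ b, ‖B₀ b‖ ≤ β₀) (hβ₁ : ∀ b, ‖B₁ b‖ ≤ β₁)
    (hγ₀ : ∀ p ∈ plaqs, ‖B₀ p.1 + B₀ p.2.1 - B₀ p.2.2.1 - B₀ p.2.2.2‖ ≤ γ₀)
    (hγ₁ : ∀ p ∈ plaqs, ‖B₁ p.1 + B₁ p.2.1 - B₁ p.2.2.1 - B₁ p.2.2.2‖ ≤ γ₁)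
    (hΛ : 1 ≤ Λ) (h4 : 4 * Λ * (β₀ + β₁) ≤ 1) (ha : γ₀ + Λ * γ₁ + 16 * Λ ^ 2 * (β₀ + β₁) ^ 2 < a)
    (hρ : β₀ + Λ * β₁ < ρ) : MapsTo (cdisc B₀ B₁) (ball 0 Λ) S := by
  intro ζ hζ
  rw [mem_ball, dist_zero_right] at hζ
  apply hS (fun b => B₀ b + ζ • B₁ b)
  refine ⟨fun p hp => ?_, fun b => ?_⟩
  · have h := norm_hol_cdisc_sub_one_le_quad B₀ B₁ p hb0 hb1 hg1 hβ₀ hβ₁ (hγ₀ p hp) (hγ₁ p hp) hΛ h4 hζ.le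
    have e : exp (B₀ p.1 + ζ • B₁ p.1) * exp (B₀ p.2.1 + ζ • B₁ p.2.1) * exp (-(B₀ p.2.2.1 + ζ • B₁ p.2.2.1)) *
        exp (-(B₀ p.2.2.2 + ζ • B₁ p.2.2.2)) = cdisc B₀ B₁ ζ p.1 * cdisc B₀ B₁ ζ p.2.1 *
        exp (-(B₀ p.2.2.1 + ζ • B₁ p.2.2.1)) * exp (-(B₀ p.2.2.2 + ζ • B₁ p.2.2.2)) := by simp [cdisc]
    rw [e]
    exact lt_of_le_of_lt h ha
  · calc ‖B₀ b + ζ • B₁ b‖ ≤ ‖B₀ b‖ + ‖ζ • B₁ b‖ := norm_add_le _ _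
      _ ≤ β₀ + ‖ζ‖ * β₁ := by rw [norm_smul]; exact add_le_add (hβ₀ b) (mul_le_mul_of_nonneg_left (hβ₁ b) (norm_nonneg _))
      _ ≤ β₀ + Λ * β₁ := by nlinarith [norm_nonneg ζ]
      _ < ρ := hρ

/-- **THE COLLARED DEPTH GAIN (offset form).**  `Φ` differentiable on an open `S` containing the small pure-potential configurations,
bounded by `N` on `S`; base potentials `B₀` (norms `≤ β₀`, abelianised plaquette sums `≤ γ₀`) and direction `B₁` (`≤ β₁`, `≤ γ₁`);
a radius `Λ > 1` with `4Λ(β₀+β₁) ≤ 1`, `γ₀ + Λγ₁ + 16Λ²(β₀+β₁)² < a`, `β₀ + Λβ₁ < ρ`.  Then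
`‖Φ(exp(B₀+B₁))‖ ≤ ‖Φ(exp B₀)‖ + 2N/Λ` — the value at the configuration is the value at the collared base point (pure gauge on
the inner region: on the road, the non-locality tail) plus the depth gain. [folklore] -/
theorem collar_gain [NormOneClass 𝔸] {S : Set (𝔅 → 𝔸)} {plaqs : Set (𝔅 × 𝔅 × 𝔅 × 𝔅)} {a ρ N : ℝ}
    {Φ : (𝔅 → 𝔸) → F} (hSo : IsOpen S) (hS : ContainsSmall S plaqs a ρ) (hΦ : DifferentiableOn ℂ Φ S)
    (hN : ∀ V ∈ S, ‖Φ V‖ ≤ N) {B₀ B₁ : 𝔅 → 𝔸} {β₀ β₁ γ₀ γ₁ Λ : ℝ} (hb0 : 0 ≤ β₀) (hb1 : 0 ≤ β₁) (hg1 : 0 ≤ γ₁)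
    (hβ₀ : ∀ b, ‖B₀ b‖ ≤ β₀) (hβ₁ : ∀ b, ‖B₁ b‖ ≤ β₁)
    (hγ₀ : ∀ p ∈ plaqs, ‖B₀ p.1 + B₀ p.2.1 - B₀ p.2.2.1 - B₀ p.2.2.2‖ ≤ γ₀)
    (hγ₁ : ∀ p ∈ plaqs, ‖B₁ p.1 + B₁ p.2.1 - B₁ p.2.2.1 - B₁ p.2.2.2‖ ≤ γ₁)
    (hΛ : 1 < Λ) (h4 : 4 * Λ * (β₀ + β₁) ≤ 1) (ha : γ₀ + Λ * γ₁ + 16 * Λ ^ 2 * (β₀ + β₁) ^ 2 < a)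
    (hρ : β₀ + Λ * β₁ < ρ) :
    ‖Φ (fun b => exp (B₀ b + B₁ b))‖ ≤ ‖Φ (fun b => exp (B₀ b))‖ + 2 * N / Λ := by
  have hmaps := mapsTo_cdisc hS hb0 hb1 hg1 hβ₀ hβ₁ hγ₀ hγ₁ hΛ.le h4 ha hρ
  have h := CovariantMeanLatticeDepth.norm_le_offset_of_disc hΛ hSo hΦ hN (differentiable_cdisc B₀ B₁) hmaps
  rwa [cdisc_one, cdisc_zero] at h

/-- **THE COLLARED DEPTH GAIN, road letters.**  If the abelianised plaquette sums of base and direction are both at relative depth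
`θ·c` inside the birth radius (`γ₀ ≤ cθa`, `γ₁ ≤ cθa` — the collar constant `c ≥ 1`), the potentials satisfy `16(β₀+β₁)² < θ²a`
(N2′ with the collar) and `β₀ + β₁ < θρ`, with `0 < θ`, `4cθ < 1`, `0 < a ≤ 1`: then with `Λ = 1/(4cθ)`,
`‖Φ(exp(B₀+B₁))‖ ≤ ‖Φ(exp B₀)‖ + 8cθ·N`. [folklore] -/
theorem collar_gain_deep [NormOneClass 𝔸] {S : Set (𝔅 → 𝔸)} {plaqs : Set (𝔅 × 𝔅 × 𝔅 × 𝔅)} {a ρ N : ℝ}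
    {Φ : (𝔅 → 𝔸) → F} (hSo : IsOpen S) (hS : ContainsSmall S plaqs a ρ) (hΦ : DifferentiableOn ℂ Φ S)
    (hN : ∀ V ∈ S, ‖Φ V‖ ≤ N) {B₀ B₁ : 𝔅 → 𝔸} {β₀ β₁ γ₀ γ₁ θ c : ℝ} (hb0 : 0 ≤ β₀) (hb1 : 0 ≤ β₁) (hg1 : 0 ≤ γ₁)
    (hβ₀ : ∀ b, ‖B₀ b‖ ≤ β₀) (hβ₁ : ∀ b, ‖B₁ b‖ ≤ β₁)
    (hγ₀ : ∀ p ∈ plaqs, ‖B₀ p.1 + B₀ p.2.1 - B₀ p.2.2.1 - B₀ p.2.2.2‖ ≤ γ₀)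
    (hγ₁ : ∀ p ∈ plaqs, ‖B₁ p.1 + B₁ p.2.1 - B₁ p.2.2.1 - B₁ p.2.2.2‖ ≤ γ₁)
    (hθ0 : 0 < θ) (hc : 1 ≤ c) (hcθ : 4 * c * θ < 1) (ha0 : 0 < a) (ha1 : a ≤ 1)
    (hγ₀θ : γ₀ ≤ c * θ * a) (hγ₁θ : γ₁ ≤ c * θ * a) (hquad : 16 * (β₀ + β₁) ^ 2 < θ ^ 2 * a)
    (hsupp : β₀ + β₁ < θ * ρ) :
    ‖Φ (fun b => exp (B₀ b + B₁ b))‖ ≤ ‖Φ (fun b => exp (B₀ b))‖ + 8 * c * θ * N := by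
  set Λ : ℝ := 1 / (4 * c * θ) with hΛ_def
  have hcθ0 : 0 < c * θ := by positivity
  have hΛcθ : Λ * (c * θ) = 1 / 4 := by rw [hΛ_def]; field_simp
  have hΛ1 : 1 < Λ := by rw [hΛ_def, lt_div_iff₀ (by positivity)]; linarith
  have hΛ0 : 0 < Λ := zero_lt_one.trans hΛ1
  have hΛθ : Λ * θ ≤ 1 / 4 := by
    have : Λ * θ ≤ Λ * (c * θ) := by
      apply mul_le_mul_of_nonneg_left _ hΛ0.le; nlinarith
    linarith
  -- potentials: `β₀ + β₁ < θ √a /4 ≤ θ/4`, so `4Λ(β₀+β₁) ≤ Λθ ≤ 1/4 ≤ 1`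
  have hββ : 4 * (β₀ + β₁) < θ := by nlinarith
  have h4 : 4 * Λ * (β₀ + β₁) ≤ 1 := by nlinarith
  have ha : γ₀ + Λ * γ₁ + 16 * Λ ^ 2 * (β₀ + β₁) ^ 2 < a := by
    have e0 : γ₀ ≤ a / 4 := by nlinarith
    have e1 : Λ * γ₁ ≤ a / 4 := by
      calc Λ * γ₁ ≤ Λ * (c * θ * a) := mul_le_mul_of_nonneg_left hγ₁θ hΛ0.le
        _ = (Λ * (c * θ)) * a := by ring
        _ = a / 4 := by rw [hΛcθ]; ring
    have e2 : 16 * Λ ^ 2 * (β₀ + β₁) ^ 2 < a / 16 := by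
      have : 16 * Λ ^ 2 * (β₀ + β₁) ^ 2 = Λ ^ 2 * (16 * (β₀ + β₁) ^ 2) := by ring
      rw [this]
      calc Λ ^ 2 * (16 * (β₀ + β₁) ^ 2) < Λ ^ 2 * (θ ^ 2 * a) := mul_lt_mul_of_pos_left hquad (by positivity)
        _ = (Λ * θ) ^ 2 * a := by ring
        _ ≤ (1 / 4) ^ 2 * a := by
            apply mul_le_mul_of_nonneg_right _ ha0.le
            exact pow_le_pow_left₀ (by positivity) hΛθ 2
        _ = a / 16 := by ring
    linarith
  have hρ : β₀ + Λ * β₁ < ρ := by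
    have e1 : β₀ + Λ * β₁ ≤ Λ * (β₀ + β₁) := by nlinarith
    have e2 : Λ * (β₀ + β₁) < Λ * (θ * ρ) := mul_lt_mul_of_pos_left hsupp hΛ0
    have e3 : Λ * (θ * ρ) = (Λ * θ) * ρ := by ring
    have hρ0 : 0 < ρ := by
      have : 0 ≤ β₀ + β₁ := by positivity
      nlinarith
    nlinarith
  have h := collar_gain hSo hS hΦ hN hb0 hb1 hg1 hβ₀ hβ₁ hγ₀ hγ₁ hΛ1 h4 ha hρ
  calc ‖Φ fun b => exp (B₀ b + B₁ b)‖ ≤ ‖Φ fun b => exp (B₀ b)‖ + 2 * N / Λ := h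
    _ = ‖Φ fun b => exp (B₀ b)‖ + 8 * c * θ * N := by rw [hΛ_def]; field_simp; ring

end Summit.QuantumFields.BalabanUV.T4Continuum.CovariantMeanCollarDisc

end
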